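import Mathlib
import Summits.NavierStokesRegularity.FluidComputer.AbcClassIIEigenpairUniqueClassII

/-!
# GROUP-B, CLASS II — THE CERTIFIED EIGENVALUE AS A CLASSICAL EIGENPAIR **WITH ITS CLASS**: `∃ u`,
# `Torus.LinNSResolventRel ν (abcFlow 1 1 1) (2πλ⋆) u 0`, `u ≠ 0`, `IsClassII (𝓕 u)` (profile-cert-3 g9, 2026-08-27)
HONEST FRAMING (D-0035/D-0074): not a claim about Navier–Stokes blow-up. WHAT THIS IS NOT: not NS evidence;
MODEL lane (NS linearised about `abcFlow 1 1 1`, class II); no certificate, number or census word moves.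
WHY (instab3 g8's «ONE GLUE ITEM», STATUS 2026-08-27T10:48Z): the INERTIA-3L consumer
`AbcInertiaRows.eq_leader_of_card_le_one` wants the certified leader as a CLASSICAL eigenpair `(λ⋆, u)` with
`IsClassII (mFourierCoeff u)`, while the 3-B-nested row theorems export `Torus.IsLinNSEigenvalue` only (class-agnostic
existence). This file supplies the missing form, once and for all rows:
* `AbcLatticeEigenSynthesis.certifier_eigenpair_abcFlow_of_certifier_eigen` — instab4's
  `isLinNSEigenvalue_abcFlow_of_certifier_eigen` WITH THE SYNTHESISED FIELD: the certifiers' eigen-equation for a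
  rapidly decaying transversal `c` (`c 0 = 0`) gives a classical solution `u` of `L u = 2πλ u` with `𝓕 u = c`
  (`linNSResolventRel_of_fourier_eigen` in place of `isLinNSEigenvalue_of_fourier_eigen`);
* `AbcClassII.isClassII_of_coordinates` — a family synthesised orbitwise from coordinates on instab4's basis
  (`c k = Σ_a w⟨O_k,a⟩ • bfam ⟨O_k,a⟩ k`, `c 0 = 0`) is CLASS II (orbits are closed under the two frequency maps;
  on each orbit `c` is a finite class-II combination);
* **`AbcClassIIEigenpair.classII_eigenpair_of_amc_coords`** — for ANY family of complex orthonormal class-II orbit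
  bases: a non-zero `amc`-coordinate eigenvector for `λ` with all moments finite (= the COORDINATES clause of
  `isLinNSEigenvalue_near_of_nested_certificate_of_complex_bases`) ⇒ `∃ u, LinNSResolventRel (1/(2πR)) (abcFlow 1 1 1)
  (2πλ) u 0 ∧ u ≠ 0 ∧ IsClassII (mFourierCoeff u)`;
* **`classII_eigenpair_of_nested_certificate`** — the 3-B-nested row (same hypotheses as cert-3 g8's general theorem)
  ⇒ `∃ λ⋆`, `‖λ⋆ − λ̃‖ ≤ 2Mr₀`, SUCH a classical class-II eigenpair, the (D7) exclusivity clause (every classical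
  class-II eigenpair `(z, u)` with `‖z − λ⋆‖ < (1 − 2√2M²r₀)/M` has `z = λ⋆`) and the REALITY clause — exactly the
  input shape of `AbcInertiaRows.eq_leader_of_card_le_one` / `card_eigenpairs_le`.
Mathlib + the files named; no new definitions. bears_on LADDER-NS N5 / Z4-a(1) → N1* T6 (INERTIA-3L census sentence
«σ(L_R|II) ∩ {Re ≥ a} = {λ⋆} EXACTLY» as one kernel theorem modulo the transcripts). [folklore].
-/

noncomputable section

open scoped BigOperators ComplexConjugate InnerProductSpace
open Finset MeasureTheory UnitAddTorus

/-! ### §1 The synthesised eigenfunction (ABC background, certifier units) -/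

namespace Summit.NavierStokesRegularity.FluidComputer.AbcLatticeEigenSynthesis

open Literature.Analysis.FunctionSpaces Literature.Analysis.FunctionSpaces.Torus
open Literature.Analysis.FunctionSpaces.EuclideanSpace
open Literature.Analysis.FluidPDE Literature.Analysis.FluidPDE.ScalarFourier
open Literature.Analysis.FluidPDE.SteadyLattice

/-- **The certifiers' eigen-equation gives a classical eigenpair WITH `𝓕 u = c`** (instab4's
`isLinNSEigenvalue_abcFlow_of_certifier_eigen`, keeping the synthesised field): `R > 0`, `λ ∈ ℂ`, `c` rapidly
decaying, transversal, `c 0 = 0`, `−(|k|²/R) c(k) + Π_k X c(k) = λ c(k)` ⇒ a classical solution `u` of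
`L(1/(2πR), abcFlow A B C) u = 2πλ · u` (`Torus.LinNSResolventRel … u 0`) with `mFourierCoeff u = c`. -/
theorem certifier_eigenpair_abcFlow_of_certifier_eigen (A B C : ℝ) {R : ℝ} (hR : 0 < R) (lam : ℂ)
    {c : (Fin 3 → ℤ) → EuclideanSpace ℂ (Fin 3)} (hc : RapidDecay c)
    (hct : ∀ k : Fin 3 → ℤ, (∑ jj : Fin 3, ((k jj : ℤ) : ℂ) * (c k) jj) = 0) (hc0 : c 0 = 0)
    (hL : ∀ k : Fin 3 → ℤ, ((-(freqNormSq k / R) : ℝ) : ℂ) • c k +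
      Torus.lerayCoeff k (∑ s ∈ Torus.abcFreq, (WithLp.toLp 2 (crossProduct
          (WithLp.ofLp (Torus.abcCoeff A B C s))
          (Complex.I • crossProduct (fun j => (((k - s) j : ℤ) : ℂ)) (WithLp.ofLp (c (k - s))) -
            WithLp.ofLp (c (k - s)))) : EuclideanSpace ℂ (Fin 3))) = lam • c k) :
    ∃ u : UnitAddTorus (Fin 3) → EuclideanSpace ℂ (Fin 3),
      Torus.LinNSResolventRel (1 / (2 * Real.pi * R)) (Torus.abcFlow A B C) (2 * Real.pi * lam) u 0 ∧
        mFourierCoeff u = c := by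
  refine linNSResolventRel_of_fourier_eigen (Torus.isSmooth_abcFlow A B C) (Torus.isDivFree_abcFlow A B C)
    (2 * Real.pi * lam) hc hct hc0 fun k => ?_
  rw [lerayCoeff_linSym_abcFlow]
  have hPX : Torus.lerayCoeff k (∑ s ∈ Torus.abcFreq, (WithLp.toLp 2 (crossProduct
          (WithLp.ofLp (Torus.abcCoeff A B C s))
          (Complex.I • crossProduct (fun j => (((k - s) j : ℤ) : ℂ)) (WithLp.ofLp (c (k - s))) -
            WithLp.ofLp (c (k - s)))) : EuclideanSpace ℂ (Fin 3))) =
      lam • c k - ((-(freqNormSq k / R) : ℝ) : ℂ) • c k := by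
    rw [← hL k, add_sub_cancel_left]
  rw [hPX]
  have hν : (((1 / (2 * Real.pi * R)) * (4 * Real.pi ^ 2 * freqNormSq k) : ℝ) : ℂ) =
      (2 * Real.pi : ℂ) * ((freqNormSq k / R : ℝ) : ℂ) := by
    have h : (1 / (2 * Real.pi * R)) * (4 * Real.pi ^ 2 * freqNormSq k) = 2 * Real.pi * (freqNormSq k / R) := by
      field_simp
      ring
    rw [h]; push_cast; ring
  rw [hν]
  push_cast
  module

end Summit.NavierStokesRegularity.FluidComputer.AbcLatticeEigenSynthesis

/-! ### §2 Orbitwise syntheses on instab4's class-II basis are class II -/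

namespace Summit.NavierStokesRegularity.FluidComputer.AbcClassII

open Literature.Analysis.FunctionSpaces Literature.Analysis.FunctionSpaces.Torus
open Literature.Analysis.FunctionSpaces.EuclideanSpace
open Literature.Analysis.FluidPDE Literature.Analysis.FluidPDE.SteadyLattice

/-- **A family synthesised orbitwise from coordinates on the class-II basis is class II**:
`c k = Σ_a w⟨O,a⟩ • bfam ⟨O,a⟩ k` for `k` in the orbit `O`, `c 0 = 0` ⇒ `IsClassII c` (each orbit is closed
under the frequency maps of `r` and `s`, and on it `c` is the finite class-II combination `Σ_a w_a bfam ⟨O,a⟩`). -/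
theorem isClassII_of_coordinates (c : Fam) (w : Idx → ℂ)
    (hc : ∀ O : Orbit, ∀ k ∈ O.1, c k = ∑ a : Fin (odim O), w ⟨O, a⟩ • bfam ⟨O, a⟩ k)
    (hc0 : c 0 = 0) : IsClassII c := by
  classical
  have hF : ∀ O : Orbit, IsClassII (∑ a : Fin (odim O), w ⟨O, a⟩ • bfam ⟨O, a⟩) := fun O =>
    isClassII_sum_smul_bfam Finset.univ (fun a : Fin (odim O) => (⟨O, a⟩ : Idx)) (fun a => w ⟨O, a⟩)
  have hcF : ∀ O : Orbit, ∀ k ∈ O.1, c k = (∑ a : Fin (odim O), w ⟨O, a⟩ • bfam ⟨O, a⟩) k := by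
    intro O k hk
    rw [hc O k hk, sum_smul_bfam_apply]
  refine ⟨?_, ?_⟩
  · funext m; ext p
    rw [rotR_apply]
    by_cases hm : m = 0
    · subst hm
      have e : (fun i : Fin 3 => (0 : Fin 3 → ℤ) ((finRotate 3).symm i)) = 0 := by funext i; rfl
      rw [e, hc0]
      rfl
    · obtain ⟨O, hmO⟩ : ∃ O : Orbit, m ∈ O.1 := ⟨toOrbit m hm, mem_sgnOrbit_self m⟩
      rw [hcF O _ (O.rotFreqR_mem hmO), hcF O m hmO]
      have h := congrArg (fun g : Fam => g m p) (hF O).1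
      simp only [rotR_apply] at h
      exact h
  · funext m; ext p
    rw [Pi.neg_apply, PiLp.neg_apply, rotS_apply]
    by_cases hm : m = 0
    · subst hm
      have e : (fun i : Fin 3 => (![1, 1, -1] : Fin 3 → ℤ) ((Equiv.swap (1 : Fin 3) 2).symm i) *
          (0 : Fin 3 → ℤ) ((Equiv.swap (1 : Fin 3) 2).symm i)) = 0 := by
        funext i; simp
      rw [e, hc0]
      simp
    · obtain ⟨O, hmO⟩ : ∃ O : Orbit, m ∈ O.1 := ⟨toOrbit m hm, mem_sgnOrbit_self m⟩
      rw [hcF O _ (O.rotFreqS_mem hmO), hcF O m hmO]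
      have h := congrArg (fun g : Fam => g m p) (hF O).2
      simp only [rotS_apply, Pi.neg_apply, PiLp.neg_apply] at h
      exact h

end Summit.NavierStokesRegularity.FluidComputer.AbcClassII

/-! ### §3 The classical class-II eigenpair from `amc`-coordinates, and from a 3-B-nested row -/

namespace Summit.NavierStokesRegularity.FluidComputer.AbcClassIIEigenpair

open Literature.Analysis.FunctionSpaces Literature.Analysis.FunctionSpaces.Torus
open Literature.Analysis.FunctionSpaces.EuclideanSpace
open Literature.Analysis.FluidPDE Literature.Analysis.FluidPDE.SteadyLattice
open Summit.NavierStokesRegularity.FluidComputer.AbcClassII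

section Classical

variable (wf : Idx → Fam)
variable (hws : ∀ i : Idx, ∀ k ∉ i.1.1, wf i k = 0)
variable (hwt : ∀ (i : Idx) (k : Fin 3 → ℤ), ∑ j : Fin 3, ((k j : ℤ) : ℂ) * wf i k j = 0)
variable (hwII : ∀ i : Idx, IsClassII (wf i))
variable (hwon : ∀ (O : Orbit) (a b : Fin (odim O)),
  ∑ k ∈ O.1, (inner ℂ (wf ⟨O, a⟩ k) (wf ⟨O, b⟩ k) : ℂ) = if a = b then 1 else 0)
variable (amc : Idx → Idx → ℂ)
variable (hamc : ∀ i j : Idx, amc i j =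
  ∑ k ∈ i.1.1, (inner ℂ (wf i k) (Torus.lerayCoeff k (crossForm 1 1 1 (wf j) k)) : ℂ))

include hws hwt hwII hwon hamc in
/-- **The classical class-II eigenpair from `amc`-coordinates.** A non-zero `amc`-coordinate eigenvector for `λ`
with all moments finite ⇒ a classical eigenpair `(2πλ, u)` of the tree's linearised operator about
`abcFlow 1 1 1` at viscosity `1/(2πR)` with `u ≠ 0` and CLASS-II Fourier coefficients. -/
theorem classII_eigenpair_of_amc_coords {R : ℝ} (hR : 1 ≤ R) (lam : ℂ)
    (wc : Idx → ℂ) (hwc0 : wc ≠ 0)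
    (hcoord : ∀ i : Idx, ((-(onormSq i.1 / R) : ℝ) : ℂ) * wc i +
      ∑ j ∈ nbrIdx i, amc i j * wc j = lam * wc i)
    (hwsum : ∀ s : ℕ, Summable fun i : Idx => (1 + onormSq i.1) ^ s * ‖wc i‖ ^ 2) :
    ∃ u : UnitAddTorus (Fin 3) → EuclideanSpace ℂ (Fin 3),
      Torus.LinNSResolventRel (1 / (2 * Real.pi * R)) (Torus.abcFlow 1 1 1) (2 * Real.pi * lam) u 0 ∧
        u ≠ 0 ∧ IsClassII (mFourierCoeff u) := by
  classical
  have hR0 : 0 < R := by linarith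
  -- transfer to instab4's real class-II basis `bfam`
  obtain ⟨wa, -, hcoordA, hsumsA, hneA⟩ := ccoord_transfer wf hws hwt hwII hwon amc hamc lam wc hcoord
  have hwsumA : ∀ s : ℕ, Summable fun i : Idx => (1 + onormSq i.1) ^ s * ‖wa i‖ ^ 2 := fun s =>
    summable_of_cube_sums (fun i => (1 + onormSq i.1) ^ s)
      (fun i => pow_nonneg (by linarith [onormSq_nonneg i.1]) _) wc wa
      (fun n => hsumsA n (fun O => (1 + onormSq O) ^ s)) (hwsum s)
  -- synthesis
  let cf : Fam := fun k => if hk : k = 0 then 0 else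
    ∑ a : Fin (odim (toOrbit k hk)), wa ⟨toOrbit k hk, a⟩ • bfam ⟨toOrbit k hk, a⟩ k
  have hcf0 : cf 0 = 0 := by simp [cf]
  have hcf : ∀ O : Orbit, ∀ k ∈ O.1, cf k = ∑ a : Fin (odim O), wa ⟨O, a⟩ • bfam ⟨O, a⟩ k := by
    intro O k hk
    have hk0 : k ≠ 0 := O.ne_zero_of_mem hk
    have hO : toOrbit k hk0 = O := (toOrbit_eq_iff hk0 O).mpr hk
    subst hO
    simp only [cf, dif_neg hk0]
  have hdecay : RapidDecay cf := rapidDecay_of_coordinates cf wa hcf hcf0 hwsumA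
  have hct := kdot_of_coordinates cf wa hcf hcf0
  have hne : cf ≠ 0 := by
    obtain ⟨i, hi⟩ : ∃ i, wa i ≠ 0 := by
      by_contra hall
      push Not at hall
      exact hneA hwc0 (funext hall)
    exact ne_zero_of_coordinates cf wa hcf hi
  have hII : IsClassII cf := isClassII_of_coordinates cf wa hcf hcf0
  have heq := certifier_eigen_of_coordinates (R := R) lam cf wa hcf hcf0 hcoordA
  obtain ⟨u, hu, hFu⟩ :=
    AbcLatticeEigenSynthesis.certifier_eigenpair_abcFlow_of_certifier_eigen 1 1 1 hR0 lam hdecay hct hcf0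
      (fun k => heq k)
  refine ⟨u, hu, fun hu0 => hne ?_, by rw [hFu]; exact hII⟩
  rw [← hFu, hu0]
  funext k
  simp [mFourierCoeff]

include hws hwt hwII hwon hamc in
/-- **The 3-B-nested row as a classical CLASS-II eigenpair** (the input shape of
`AbcInertiaRows.eq_leader_of_card_le_one`): the hypotheses of cert-3 g8's
`isLinNSEigenvalue_near_of_nested_certificate_of_complex_bases` ⇒ `∃ λ⋆`, `‖λ⋆ − λ̃‖ ≤ 2Mr₀`, a classical solution
`u ≠ 0` of `L u = 2πλ⋆ u` about `abcFlow 1 1 1` at `ν = 1/(2πR)` with `IsClassII (𝓕 u)`, the (D7) exclusivity of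
`λ⋆` among classical class-II eigenvalues within `(1 − 2√2M²r₀)/M`, and REALITY. -/
theorem classII_eigenpair_of_nested_certificate {R : ℝ} (hR : 1 ≤ R) (K Kv : ℕ) (lt : ℂ)
    (vt : Idx → ℂ) (hvt0 : ∀ i, i ∉ cubeIdx Kv → vt i = 0)
    {r₀ nt : ℝ} (hr₀ : 0 ≤ r₀) (hnt : 0 ≤ nt)
    (hres : ∑ i ∈ cubeIdx Kv ∪ (cubeIdx Kv).biUnion nbrIdx,
      ‖(if i ∈ cubeIdx Kv then (lt - ((-(onormSq i.1 / R) : ℝ) : ℂ)) * vt i else 0) -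
        ∑ j ∈ cubeIdx Kv, amc i j * vt j‖ ^ 2 ≤ r₀ ^ 2)
    (hntb : ∑ i ∈ cubeIdx Kv \ cubeIdx K, ‖vt i‖ ^ 2 ≤ nt ^ 2)
    (Binv : ((↥(cubeIdx K) → ℂ) × ℂ) →ₗ[ℂ] ((↥(cubeIdx K) → ℂ) × ℂ))
    (hBinv : ∀ (c : ↥(cubeIdx K) → ℂ) (m : ℂ),
      Binv (fun i : ↥(cubeIdx K) => (lt - ((-(onormSq i.1.1 / R) : ℝ) : ℂ)) * c i -
          ∑ j : ↥(cubeIdx K), amc i j * c j + m * vt i,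
        ∑ i : ↥(cubeIdx K), conj (vt i) * c i) = (c, m))
    {α βB βC gB : ℝ} (hα : 0 ≤ α) (hβB : 0 ≤ βB) (hβC : 0 ≤ βC) (hgB : 0 ≤ gB)
    (hαM : ∀ (c : ↥(cubeIdx K) → ℂ) (g : ℂ),
      ∑ j : ↥(cubeIdx K), ‖(Binv (c, g)).1 j‖ ^ 2 + ‖(Binv (c, g)).2‖ ^ 2 ≤
        α ^ 2 * (∑ i : ↥(cubeIdx K), ‖c i‖ ^ 2 + ‖g‖ ^ 2))
    (hβBM : ∀ e : Idx → ℂ,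
      ∑ j : ↥(cubeIdx K), ‖(Binv (fun i : ↥(cubeIdx K) => -∑ j ∈ nbrIdx i \ cubeIdx K,
          amc i j * e j, 0)).1 j‖ ^ 2 +
        ‖(Binv (fun i : ↥(cubeIdx K) => -∑ j ∈ nbrIdx i \ cubeIdx K,
          amc i j * e j, 0)).2‖ ^ 2 ≤
        βB ^ 2 * ∑ j ∈ (cubeIdx K).biUnion nbrIdx \ cubeIdx K, ‖e j‖ ^ 2)
    (hβCM : ∀ (c : ↥(cubeIdx K) → ℂ) (g : ℂ),
      ∑ i ∈ ((cubeIdx K).biUnion nbrIdx ∪ cubeIdx Kv) \ cubeIdx K,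
        ‖-∑ j : ↥(cubeIdx K), amc i j * (Binv (c, g)).1 j +
          (Binv (c, g)).2 * vt i‖ ^ 2 ≤ βC ^ 2 * (∑ i : ↥(cubeIdx K), ‖c i‖ ^ 2 + ‖g‖ ^ 2))
    (hgBM : ∀ e : Idx → ℂ,
      ‖(Binv (fun i : ↥(cubeIdx K) => ∑ j ∈ nbrIdx i \ cubeIdx K,
          amc i j * e j, 0)).2‖ ^ 2 ≤
        gB ^ 2 * ∑ j ∈ (cubeIdx K).biUnion nbrIdx \ cubeIdx K, ‖e j‖ ^ 2)
    {MU2 μ M : ℝ}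
    (hshellM : ∀ e : Idx → ℂ, (∀ i ∈ cubeIdx K, e i = 0) →
      MU2 * ∑ i ∈ cubeIdx (K + 1) \ cubeIdx K, ‖e i‖ ^ 2 ≤
        ∑ i ∈ cubeIdx (K + 1) \ cubeIdx K, (lt.re - (-(onormSq i.1 / R)) - Real.sqrt 2) * ‖e i‖ ^ 2 -
        RCLike.re (∑ i ∈ (cubeIdx K).biUnion nbrIdx \ cubeIdx K,
          conj (∑ j : ↥(cubeIdx K), amc i j *
            (Binv (fun i : ↥(cubeIdx K) => ∑ j ∈ nbrIdx i \ cubeIdx K,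
              amc i j * e j, 0)).1 j) * e i))
    (htailK : MU2 ≤ lt.re + ((K : ℝ) + 2) ^ 2 / R - Real.sqrt 2)
    (hμdef : μ = MU2 - gB * nt) (hμ : 0 < μ)
    (hMdef : M = √((1 + βC ^ 2) / μ ^ 2 + (α + βB * √(1 + βC ^ 2) / μ) ^ 2))
    (hκ : 2 * Real.sqrt 2 * M ^ 2 * r₀ < 1) :
    ∃ lam : ℂ, ‖lam - lt‖ ≤ 2 * M * r₀ ∧
      (∃ u : UnitAddTorus (Fin 3) → EuclideanSpace ℂ (Fin 3),
        Torus.LinNSResolventRel (1 / (2 * Real.pi * R)) (Torus.abcFlow 1 1 1) (2 * Real.pi * lam) u 0 ∧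
          u ≠ 0 ∧ IsClassII (mFourierCoeff u)) ∧
      (∀ (z : ℂ) (u : UnitAddTorus (Fin 3) → EuclideanSpace ℂ (Fin 3)),
        Torus.LinNSResolventRel (1 / (2 * Real.pi * R)) (Torus.abcFlow 1 1 1) (2 * Real.pi * z) u 0 → u ≠ 0 →
          IsClassII (mFourierCoeff u) → ‖z - lam‖ < (1 - 2 * Real.sqrt 2 * M ^ 2 * r₀) / M → z = lam) ∧
      (lt.im = 0 → 2 * (2 * M * r₀) < (1 - 2 * Real.sqrt 2 * M ^ 2 * r₀) / M → lam.im = 0) := by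
  obtain ⟨lam, hclose, -, hisol, hreal, wc, hwc0, hcoord, hwsum⟩ :=
    isLinNSEigenvalue_near_of_nested_certificate_of_complex_bases wf hws hwt hwII hwon amc hamc hR
      K Kv lt vt hvt0 hr₀ hnt hres hntb Binv hBinv hα hβB hβC hgB hαM hβBM hβCM hgBM hshellM htailK hμdef hμ hMdef hκ
  exact ⟨lam, hclose, classII_eigenpair_of_amc_coords wf hws hwt hwII hwon amc hamc hR lam wc hwc0 hcoord hwsum,
    fun z u hu hu0 hII hz => eq_of_classII_eigenfunction_of_isolated wf hws hwt hwII hwon amc hamc hR lam z hisol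
      hu hu0 hII hz, hreal⟩

end Classical

end Summit.NavierStokesRegularity.FluidComputer.AbcClassIIEigenpair

end
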